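import Summits.BirchSwinnertonDyer.BirchSwinnertonDyer.Theorems.GenusKolyvaginAtTwoOffCutResidualAtTwoRStrictDefTwoSupply
import HarnessLib

/-!
# Route `GenusKolyvaginAtTwo`, crux U₂ `MinimalTwinBSDTwo` (stmt-BirchSwinnertonDyer-22985), LINE 23 «twin_swap» residual OFF″ (the `Δ > 0`
# IDENTITY LOCUS off the egg): a COMPOSITE-`d_K` IDENTITY DOOR WITH ITS SUPPLY — a `2`-Selmer-TRIVIAL Heegner twin `W^{(−ℓp)}` of Tamagawa
# defect `+2`, at every depth, unconditionally

Seat `bsd-line-gk2-p5` g39 (WIDTH-5 attach, cell `bsd-f1-sign2`), `--supports stmt-BirchSwinnertonDyer-22985` (helper; closes nothing).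
THEOREMS ONLY (no definition, no named fact, no `sorry`; standard axioms).  **BSD is NOT proved by this; U₂, the wall, the converses, EXP and
item 32821 stay open; no item is closed.**

WHAT.  gk2-p2 g26 (LINE 23 holder) is turning the residual OFF″ = «`Δ > 0 ∧ ¬MeetsEgg ∧ ¬(ord₂ C = 0 ∧ full 2-adic image)`» into «EXP_id + an
identity-door SUPPLY stub» with a PRIME identity door `K = ℚ(√−ℓ)` (`ℓ` an identity prime at which `loc_ℓ` is injective on `Sel₂^{rel ∞}(W)`;
count by the mixed two-place Kummer index).  This file offers the door in COMPOSITE form with the supply INCLUDED, as one package in U₂'s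
currency: for `W/ℚ` globally minimal with `Δ_W > 0`, `ρ̄_{W,2}` onto, `#Sel₂(W) = 2` and `Sel₂(W)` strict at `ℝ` (= off the egg), at ANY
Tamagawa depth, there are a silent prime `ℓ ≡ 7 (8)` and an identity prime `p ≡ 1 (8)` (`#W(ℚ_p)[2] = 4`; `ℓ ≡ −1`, `p ≡ 1 (mod r)` for every
odd `r ∣ N_W`), the Heegner field `K = ℚ(√(−ℓp))` with EVERY K-clause of the route (imaginary quadratic, `d_K = −ℓp` odd `≠ −3`, Heegner for
`N_W`, `2` split, the two Theorem-B₂ non-squares), and a GLOBALLY MINIMAL twin `Wd ≅ W^{(d_K)}` with **`#Sel₂(Wd) = 1`** and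
**`ord₂ C(Wd) = ord₂ C(W) + 2`** — `exists_heegnerField_selmerTrivialTwin_of_strict`, a repackaging of the prequel's
`exists_defectTwo_selmerTrivialTwin_of_strict` ∘ `exists_heegnerField_neg_mul` (mechanism: all-silent twist RAISES `2 → 4`, gk2-p4 g12's T-A law;
Mazur–Rubin Prop. 5.2 at `2`, LEAD gk2-p1 g8, lowers `4 → 1` at a split = identity twisting prime; Kramer's twin Tamagawa valuation).
The companion `exists_heegnerField_minimalTwin_of_strict_four` is the `#Sel₂(W) = 4`, `C(W)` odd case in the same currency (LINE 24 A⁼² with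
the door data kept).

References: [MazurRubin2010] Prop. 5.2 (proof), Cor. 3.4 (i), Lemma 2.11; [Kramer1981] §2 Prop. 3, Prop. 6, Thm. 1; [GrossLMS1991] §1 (p. 235).
-/

set_option linter.dupNamespace false -- tree convention: `Summit.BirchSwinnertonDyer.BirchSwinnertonDyer.Theorems` (summit = sub-problem)
set_option autoImplicit false

noncomputable section

open scoped Classical

namespace Summit.BirchSwinnertonDyer.BirchSwinnertonDyer.Theorems.GenusExact.StrictDefTwo

open WeierstrassCurve NumberField
open Literature.NumberTheory.EllipticCurves Literature.NumberTheory.GaloisRepresentations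

/-- **COMPOSITE IDENTITY DOOR WITH SUPPLY (`#Sel₂(W) = 2`, strict at `ℝ`, any depth): a `2`-Selmer-TRIVIAL Heegner twin `W^{(−ℓp)}` with every
K-clause of the route and `ord₂ C(Wd) = ord₂ C(W) + 2`.**  Unconditional (Čebotarev, Poitou–Tate, Tate's χ, Kramer's congruence, Mazur–Rubin
Prop. 5.2 at `2` are tree theorems).  BSD is NOT proved by this; U₂ stays open.
[cite: MazurRubin2010, Prop. 5.2 (proof), Cor. 3.4 (i)] [cite: Kramer1981, §2 Prop. 3, Thm. 1] [cite: GrossLMS1991, §1 (p. 235)] -/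
theorem exists_heegnerField_selmerTrivialTwin_of_strict (W : WeierstrassCurve ℚ) [W.IsElliptic] [W.IsGloballyMinimal]
    (hΔ : 0 < W.Δ) (hsurj : W.HasSurjectiveModNGaloisRep 2) (h2 : Nat.card (W.selmerGroup 2) = 2)
    (hstrict : ∀ c ∈ (W.kummerSelmerStructure ((2 : ℕ) : ℤ)).selmerGroup,
      galoisCohomology.localization (W.torsionGaloisModule ((2 : ℕ) : ℤ)) (Sum.inl Rat.infinitePlace) 1 c = 0) :
    ∃ ℓ p : ℕ, ℓ.Prime ∧ p.Prime ∧ ℓ ≠ p ∧ ℓ % 8 = 7 ∧ (p : ℤ) % 8 = 1 ∧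
      (∀ r : ℕ, r.Prime → r ∣ W.conductorNorm ℤ → r ≠ 2 → (ℓ : ZMod r) = -1 ∧ (p : ZMod r) = 1) ∧
      ¬ ℓ ∣ W.conductorNorm ℤ ∧ ¬ p ∣ W.conductorNorm ℤ ∧
      (∀ x : ZMod ℓ, 4 * x ^ 3 + ((integralModelInt W).b₂ : ZMod ℓ) * x ^ 2 +
        2 * ((integralModelInt W).b₄ : ZMod ℓ) * x + ((integralModelInt W).b₆ : ZMod ℓ) ≠ 0) ∧
      (∀ _h : Fact p.Prime, Nat.card {Q : (W.baseChange ℚ_[p]).toAffine.Point // 2 • Q = 0} = 4) ∧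
      ∃ (K : Type) (_ : Field K) (_ : NumberField K), IsImaginaryQuadratic K ∧ NumberField.discr K = -((ℓ : ℤ) * p) ∧
        Odd (NumberField.discr K) ∧ NumberField.discr K ≠ -3 ∧ SatisfiesHeegnerHypothesis (W.conductorNorm ℤ) K ∧
        ((Ideal.span {(2 : ℤ)}).primesOver (𝓞 K)).ncard = 2 ∧
        ¬ IsSquare ((NumberField.discr K : ℚ) * -|W.Δ|) ∧ ¬ IsSquare ((NumberField.discr K : ℚ) * (-(2 * |W.Δ|))) ∧
        ∃ (Wd : WeierstrassCurve ℚ) (_ : Wd.IsElliptic) (_ : Wd.IsGloballyMinimal),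
          (∃ C : VariableChange ℚ, C • W.quadraticTwist (NumberField.discr K : ℚ) = Wd) ∧
          Nat.card (Wd.selmerGroup 2) = 1 ∧ padicValNat 2 Wd.tamagawaProduct = padicValNat 2 W.tamagawaProduct + 2 := by
  obtain ⟨ℓ, p, hℓ, hp, hℓp, h3ℓ, hℓ8, hp8, hcong, hℓN, hpN, hsil, hid, Wd, _, _, ⟨C, hC⟩, hSel, hDEF⟩ :=
    exists_defectTwo_selmerTrivialTwin_of_strict W hΔ hsurj h2 hstrict
  obtain ⟨K, _, _, hIQ, hdisc, hodd, hne3, hHe, h2K, hsq1, hsq2⟩ := exists_heegnerField_neg_mul W hℓ hp hℓp h3ℓ hℓ8 hp8 hcong hℓN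
  exact ⟨ℓ, p, hℓ, hp, hℓp, hℓ8, hp8, hcong, hℓN, hpN, hsil, hid, K, inferInstance, inferInstance, hIQ, hdisc, hodd, hne3, hHe, h2K, hsq1, hsq2,
    Wd, inferInstance, inferInstance, ⟨C, by rw [hdisc]; exact hC⟩, hSel, hDEF⟩

/-- **COMPOSITE IDENTITY DOOR WITH SUPPLY (`#Sel₂(W) = 4`, strict at `ℝ`, `C(W)` odd): the `2`-Selmer-MINIMAL defect-2 Heegner twin `W^{(−ℓp)}`
of LINE 24 A⁼² with the door data and every K-clause kept** (`#Sel₂(Wd) = 2`, `ord₂ C(Wd) = 2`).  BSD is NOT proved by this.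
[cite: MazurRubin2010, Prop. 5.2 (proof), Cor. 3.4 (i)] [cite: Kramer1981, §2 Prop. 3, Thm. 1] [cite: GrossLMS1991, §1 (p. 235)] -/
theorem exists_heegnerField_minimalTwin_of_strict_four (W : WeierstrassCurve ℚ) [W.IsElliptic] [W.IsGloballyMinimal]
    (hΔ : 0 < W.Δ) (hTam : Odd W.tamagawaProduct) (hsurj : W.HasSurjectiveModNGaloisRep 2) (h4 : Nat.card (W.selmerGroup 2) = 4)
    (hstrict : ∀ c ∈ (W.kummerSelmerStructure ((2 : ℕ) : ℤ)).selmerGroup,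
      galoisCohomology.localization (W.torsionGaloisModule ((2 : ℕ) : ℤ)) (Sum.inl Rat.infinitePlace) 1 c = 0) :
    ∃ ℓ p : ℕ, ℓ.Prime ∧ p.Prime ∧ ℓ ≠ p ∧ ℓ % 8 = 7 ∧ (p : ℤ) % 8 = 1 ∧
      (∀ r : ℕ, r.Prime → r ∣ W.conductorNorm ℤ → r ≠ 2 → (ℓ : ZMod r) = -1 ∧ (p : ZMod r) = 1) ∧
      ¬ ℓ ∣ W.conductorNorm ℤ ∧ ¬ p ∣ W.conductorNorm ℤ ∧
      (∀ x : ZMod ℓ, 4 * x ^ 3 + ((integralModelInt W).b₂ : ZMod ℓ) * x ^ 2 +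
        2 * ((integralModelInt W).b₄ : ZMod ℓ) * x + ((integralModelInt W).b₆ : ZMod ℓ) ≠ 0) ∧
      (∀ _h : Fact p.Prime, Nat.card {Q : (W.baseChange ℚ_[p]).toAffine.Point // 2 • Q = 0} = 4) ∧
      ∃ (K : Type) (_ : Field K) (_ : NumberField K), IsImaginaryQuadratic K ∧ NumberField.discr K = -((ℓ : ℤ) * p) ∧
        Odd (NumberField.discr K) ∧ NumberField.discr K ≠ -3 ∧ SatisfiesHeegnerHypothesis (W.conductorNorm ℤ) K ∧
        ((Ideal.span {(2 : ℤ)}).primesOver (𝓞 K)).ncard = 2 ∧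
        ¬ IsSquare ((NumberField.discr K : ℚ) * -|W.Δ|) ∧ ¬ IsSquare ((NumberField.discr K : ℚ) * (-(2 * |W.Δ|))) ∧
        ∃ (Wd : WeierstrassCurve ℚ) (_ : Wd.IsElliptic) (_ : Wd.IsGloballyMinimal),
          (∃ C : VariableChange ℚ, C • W.quadraticTwist (NumberField.discr K : ℚ) = Wd) ∧
          Nat.card (Wd.selmerGroup 2) = 2 ∧ padicValNat 2 Wd.tamagawaProduct = 2 := by
  obtain ⟨ℓ, p, hℓ, hp, hℓp, h3ℓ, hℓ8, hp8, hcong, hℓN, hpN, hsil, hid, Wd, _, _, ⟨C, hC⟩, hSel, hDEF⟩ :=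
    exists_defectTwo_minimalTwin_of_strict W hΔ hTam hsurj h4 hstrict
  obtain ⟨K, _, _, hIQ, hdisc, hodd, hne3, hHe, h2K, hsq1, hsq2⟩ := exists_heegnerField_neg_mul W hℓ hp hℓp h3ℓ hℓ8 hp8 hcong hℓN
  exact ⟨ℓ, p, hℓ, hp, hℓp, hℓ8, hp8, hcong, hℓN, hpN, hsil, hid, K, inferInstance, inferInstance, hIQ, hdisc, hodd, hne3, hHe, h2K, hsq1, hsq2,
    Wd, inferInstance, inferInstance, ⟨C, by rw [hdisc]; exact hC⟩, hSel, hDEF⟩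

end Summit.BirchSwinnertonDyer.BirchSwinnertonDyer.Theorems.GenusExact.StrictDefTwo

end
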